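import Summits.BirchSwinnertonDyer.BirchSwinnertonDyer.Theorems.ManinLocalTwoThreeNotTrivialEisensteinModThreeWitness
import Summits.BirchSwinnertonDyer.BirchSwinnertonDyer.Theorems.ManinLocalTwoThreeShimuraIndexMuThree
import HarnessLib

/-!
# E-es-69♯ `NotTrivialEisensteinModThreeOfNoThreeTorsionOfNoMuThree` is a THEOREM, and hNT₃(3) is modulus-free:
# ONE good prime `ℓ ≠ 3` with `a_ℓ(W) ≢ ℓ + 1 (mod 3)` decides it

Summit `BirchSwinnertonDyer`, route `ManinLocalTwoThree` (cell bsd-f2-manin), crux C3 `ManinPrimeToThreeAtNine`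
(stmt-BirchSwinnertonDyer-22968); sequel of `ManinLocalTwoThreeNotTrivialEisensteinModThree` (E-es-40₃) and
`ManinLocalTwoThreeNotTrivialEisensteinModThreeWitness` (E-es-69♭, and the Chebotarev engine
`exists_prime_modEq_one_not_three_dvd_reductionPointCount_of_smul_ne`: ONE `τ ∈ Γ_ℚ` fixed-point-free on `W[3]` gives, for
every finite `S` and every `M`, primes `r ∉ S`, `r ≡ 1 (mod 3^{M+1})`, with `3 ∤ #W̃(𝔽_r)`).  es's hypothesis hNT₃(3) =
`KatoCurve.NotTrivialEisensteinModThreeAt W 3` (MEMO-es §32; the localisation hypothesis of E-es-69 and of the RES₃-habitat cut of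
E-es-61) quantifies over all `3`-power moduli; here:

* §1 `notTrivialEisensteinModThreeAt_of_smul_ne` — a fixed-point-free `τ` on `W[3]` ⟹ hNT₃(3) (engine + `a_r = tr`, globally minimal `W`).
* §2 `notTrivialEisensteinModThreeAt_of_prime`, **`notTrivialEisensteinModThreeAt_iff_exists_prime`** — hNT₃(3) ⟺ SOME good prime
  `ℓ ≠ 3` (either residue) has `a_ℓ ≢ ℓ + 1 (mod 3)`: an arithmetic Frobenius `φ_ℓ` has trace `a_ℓ` (Serre 1981 (238), tree
  `trace_galoisRepTorsion_frobenius_eq`) and determinant `χ̄₃(φ_ℓ) ≡ ℓ` on `W[3]`, and over `𝔽₃` «`tr A ≠ 1 + det A` ⟹ no fixed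
  vector» (`mulVec_ne_of_trace_ne_one_add_det`, `decide` on residues); «⟹» is the instance `S = {3} ∪ {p ∣ Δ_min}`, `M = 0`.  So the
  census column of E43 (one prime) decides hNT₃(3) exactly.
* §3 **`notTrivialEisensteinModThreeOfNoThreeTorsionOfNoMuThree_holds`** — es's E-es-69♯ (the RESIDUE IDENTIFICATION: optimal datum
  `D`, no rational `3`-torsion on `E_{W,c}`, `W ⊉ μ₃` ⟹ hNT₃(3)), proved WITHOUT its reducibility hypothesis: if NO `τ` were
  fixed-point-free on `W[3]`, Katz's case split (tree `exists_addOrderOf_eq_or_exists_trivialQuotientLine_of_forall_exists_smul_eq`,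
  lead p1 g9) gives a rational point of order `3` (⟹ `IsShortThreeTorsion`, `exists_isShortThreeTorsion_of_addOrderOf_eq_three`) or a
  `Γ_ℚ`-stable `3`-line with trivial quotient character (⟹ `HasShortMuThree`, `hasShortMuThree_of_trivialQuotientLine`, the Weil
  pairing), against the hypotheses (`c ≠ 0`: `maninConstant_ne_zero_holds`); otherwise §1.  Hence es's EDGE 2 with two binders left:
  `threeAdicUnitWitness_noMuThree_of_h69` — E-es-61's generic cut ⟸ E-es-69 ∧ E-es-69♮.

Axioms `propext`, `Classical.choice`, `Quot.sound`; no new definitions.  Nothing about BSD or Manin's conjecture is proved here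
(E-es-69/69♮, C3 OPEN).  References: J.-P. Serre, Publ. Math. IHÉS 54 (1981) §8 (238); J. Tate, GCFT (Cassels–Fröhlich 1967) §2.4;
N. M. Katz, Invent. Math. 62 (1981) Thm. 2; J. H. Silverman, *AEC* III.8; HOME/MEMO-es.md §32.
-/

set_option autoImplicit false
set_option linter.dupNamespace false

noncomputable section

open scoped Classical Matrix

open NumberField IsDedekindDomain Field WeierstrassCurve
  Literature.NumberTheory.EllipticCurves Literature.NumberTheory.EllipticCurves.ModularForms
  Literature.NumberTheory.GaloisRepresentations
  Summit.BirchSwinnertonDyer.Rank1Residual.ManinAdditive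
  Summit.BirchSwinnertonDyer.Rank1Residual.ManinAdditive.KatoCurve

namespace Summit.BirchSwinnertonDyer.BirchSwinnertonDyer.Theorems.ManinLocalTwoThree

/-- The units of `𝔽₃` are `±1` (local copy). [folklore] -/
private theorem units_zmod_three' (u : (ZMod 3)ˣ) : u = 1 ∨ u = -1 := by
  fin_cases u <;> decide

/-- The rational prime below a finite place `v` of `ℚ` lies in `v` (local copy of the tree's
`natCast_natGenerator_mem_asIdeal`). [folklore] -/
private theorem natCast_primesEquiv_mem_asIdeal' (v : HeightOneSpectrum (𝓞 ℚ)) :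
    (((Rat.HeightOneSpectrum.primesEquiv v : Nat.Primes) : ℕ) : 𝓞 ℚ) ∈ v.asIdeal := by
  have h := (Rat.HeightOneSpectrum.natGenerator_dvd_iff v).mp dvd_rfl
  rwa [← map_natCast (Rat.IsIntegralClosure.intEquiv (𝓞 ℚ)), Ideal.apply_mem_of_equiv_iff] at h

/-! ### §1  A fixed-point-free element gives hNT₃(3) -/

/-- **hNT₃(3) from a fixed-point-free `τ`** (globally minimal model): the engine
`exists_prime_modEq_one_not_three_dvd_reductionPointCount_of_smul_ne` read through `a_r = tr Frob_r` and `3 ∣ a_r − (r + 1) ⟺ 3 ∣ #W̃(𝔽_r)`.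
[cite: TateGCFT1967, §2.4 (Tchebotarev density theorem)] -/
theorem notTrivialEisensteinModThreeAt_of_smul_ne (W : WeierstrassCurve ℚ) [W.IsElliptic] [W.IsGloballyMinimal]
    (τ : absoluteGaloisGroup ℚ) (hτ : ∀ P : W.geomTorsion ((3 : ℕ) : ℤ), P ≠ 0 → τ • P ≠ P) :
    NotTrivialEisensteinModThreeAt W 3 := by
  classical
  intro S M
  obtain ⟨r, hr, hrS, _, hmod, hgoodr, hndvd⟩ :=
    exists_prime_modEq_one_not_three_dvd_reductionPointCount_of_smul_ne W τ hτ S M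
  refine ⟨r, hr.out, hrS, ?_, ?_⟩
  · rw [pow_succ'] at hmod
    exact Nat.ModEq.of_mul_left 3 hmod
  · rw [WeierstrassCurve.LFunction_apply_prime_eq_frobeniusTrace W r hgoodr]
    intro heq
    apply hndvd
    have h3 : ((((r : ℤ) + 1 : ℤ)) : ZMod 3) = ((W.frobeniusTrace r : ℤ) : ZMod 3) := by
      rw [heq]; push_cast; ring
    have h3' := (ZMod.intCast_eq_intCast_iff_dvd_sub ((r : ℤ) + 1) (W.frobeniusTrace r) 3).mp h3
    exact (dvd_frobeniusTrace_sub_iff W 3 r).mp (by exact_mod_cast h3')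

/-! ### §2  One non-Eisenstein prime suffices -/

/-- Residue core (`decide`): over `𝔽₃`, `a + d ≠ 1 + (ad − bc)` ⟹ `(a b; c d)` fixes no non-zero vector (`1` is not a root of
`x² − (a + d)x + (ad − bc)`). [folklore] -/
theorem fixedPointFree_of_trace_ne_one_add_det_zmod3 :
    ∀ a b c d : ZMod 3, a + d ≠ 1 + (a * d - b * c) →
      ∀ x y : ZMod 3, a * x + b * y = x → c * x + d * y = y → x = 0 ∧ y = 0 := by
  decide

/-- **A `2 × 2` matrix over `𝔽₃` with `tr A ≠ 1 + det A` fixes no non-zero vector.** [folklore] -/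
theorem mulVec_ne_of_trace_ne_one_add_det (A : Matrix (Fin 2) (Fin 2) (ZMod 3)) (h : A.trace ≠ 1 + A.det) :
    ∀ v : Fin 2 → ZMod 3, v ≠ 0 → A.mulVec v ≠ v := by
  intro v hv hfix
  rw [Matrix.trace_fin_two, Matrix.det_fin_two] at h
  rw [mulVec_fin_two] at hfix
  have h0 := congrFun hfix 0
  have h1 := congrFun hfix 1
  simp only [Matrix.cons_val_zero, Matrix.cons_val_one] at h0 h1
  have key := fixedPointFree_of_trace_ne_one_add_det_zmod3 (A 0 0) (A 0 1) (A 1 0) (A 1 1) h (v 0) (v 1) h0 h1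
  apply hv
  ext i; fin_cases i
  · exact key.1
  · exact key.2

/-- **hNT₃(3) from ONE non-Eisenstein good prime, of either residue mod `3`** (globally minimal model): if `ℓ ≠ 3` is a prime of good
reduction with `a_ℓ(W) ≢ ℓ + 1 (mod 3)`, then for EVERY finite `S` and EVERY `M` some prime `r ∉ S`, `r ≡ 1 (mod 3^M)`, has
`a_r(W) ≢ r + 1 (mod 3)`.  An arithmetic Frobenius `φ_ℓ` has trace `a_ℓ` and determinant `χ̄₃(φ_ℓ) ≡ ℓ` on `W[3]` (`φ_ℓ ζ₃ = ζ₃^ℓ`), so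
`tr ≠ 1 + det` and `φ_ℓ` is fixed-point-free (`mulVec_ne_of_trace_ne_one_add_det`); then §2.  In particular hNT₃(3) does not depend on
the `3`-power modulus: its `M = 0` instance implies all others. [cite: Serre1981, §8.1 eq. (238) (p. 188)]
[cite: TateGCFT1967, §2.4 (Tchebotarev density theorem)] -/
theorem notTrivialEisensteinModThreeAt_of_prime (W : WeierstrassCurve ℚ) [W.IsElliptic] [W.IsGloballyMinimal]
    {ℓ : ℕ} [Fact ℓ.Prime] (hℓ3 : ℓ ≠ 3) (hgood : W.HasGoodReductionAtPrime ℓ)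
    (ha : ((W.LFunction ℓ : ℤ) : ZMod 3) ≠ (ℓ : ZMod 3) + 1) : NotTrivialEisensteinModThreeAt W 3 := by
  classical
  have hℓ : ℓ.Prime := Fact.out
  haveI : Fact (Nat.Prime 3) := ⟨Nat.prime_three⟩
  haveI : NeZero ((3 : ℕ) : ℚ) := ⟨by norm_num⟩
  -- the place, a prime of `\bar ℤ` above it, an arithmetic Frobenius
  set v : HeightOneSpectrum (𝓞 ℚ) := (Rat.HeightOneSpectrum.primesEquiv (R := 𝓞 ℚ)).symm ⟨ℓ, hℓ⟩ with hvdef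
  have hvℓ : ((Rat.HeightOneSpectrum.primesEquiv v : Nat.Primes) : ℕ) = ℓ := by
    rw [hvdef, Equiv.apply_symm_apply]
  have hv : (ℓ : 𝓞 ℚ) ∈ v.asIdeal := by
    have h := natCast_primesEquiv_mem_asIdeal' v
    rwa [hvℓ] at h
  obtain ⟨𝔓, h𝔓⟩ := HeightOneSpectrum.primesAbove_nonempty v
  obtain ⟨φ, hφ⟩ := HeightOneSpectrum.exists_isArithFrobAt_of_mem_primesAbove_holds h𝔓
  -- the frame and the matrix of `φ`
  obtain ⟨e, Φ, hframe, htrace, hdet, -, -⟩ := exists_frame_galoisRepTorsion_rat W 3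
  set A : Matrix (Fin 2) (Fin 2) (ZMod 3) := ((Φ (galoisRepTorsion W ((3 : ℕ) : ℤ) φ) : GL (Fin 2) (ZMod 3)) :
    Matrix (Fin 2) (Fin 2) (ZMod 3)) with hAdef
  have htrA : A.trace = ((W.LFunction ℓ : ℤ) : ZMod 3) := by
    rw [hAdef, htrace, W.trace_galoisRepTorsion_frobenius_eq 3 hℓ3 hgood hvℓ h𝔓 hφ,
      ← W.LFunction_apply_prime_eq_frobeniusTrace ℓ hgood]
  -- `det A = χ̄₃(φ)` and `χ̄₃(φ) ≡ ℓ (mod 3)`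
  obtain ⟨ζ₃, hζ₃⟩ := HasEnoughRootsOfUnity.prim (M := AlgebraicClosure ℚ) (n := 3)
  have hζ₃pow : ζ₃ ^ 3 ^ 1 = 1 := by rw [pow_one]; exact hζ₃.pow_eq_one
  have hne : ζ₃ ≠ 0 := hζ₃.ne_zero (by norm_num)
  have hφζ : φ • ζ₃ = ζ₃ ^ ℓ := frob_smul_eq_pow_of_pow_eq_one_prime (k := 1) hℓ Nat.prime_three hℓ3 hv h𝔓 hφ hζ₃pow
  have hspec := modPCyclotomicCharacterZMod_spec ℚ 3 φ ζ₃ hζ₃.pow_eq_one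
  rw [hφζ] at hspec
  -- `ζ₃ ^ ℓ = ζ₃ ^ (χ φ).val` ⟹ `3 ∣ ` the difference of exponents
  have hmod3 : ℓ % 3 = 1 ∨ ℓ % 3 = 2 := by
    have h0 : ℓ % 3 ≠ 0 := fun h0 ↦ by
      have h3 : 3 ∣ ℓ := Nat.dvd_of_mod_eq_zero h0
      exact hℓ3 ((Nat.prime_dvd_prime_iff_eq Nat.prime_three hℓ).mp h3).symm
    omega
  have hdetA : A.det = (ℓ : ZMod 3) := by
    rw [hAdef, ← Matrix.GeneralLinearGroup.val_det_apply, hdet]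
    have hℓcast : (ℓ : ZMod 3) = ((ℓ % 3 : ℕ) : ZMod 3) := by rw [ZMod.natCast_mod]
    rcases units_zmod_three' (modPCyclotomicCharacterZMod ℚ 3 φ) with h1 | hm1
    · rw [h1, Units.val_one, ZMod.val_one, pow_one] at hspec
      rcases hmod3 with hl | hl
      · rw [h1, Units.val_one, hℓcast, hl]; rfl
      · exfalso
        -- `ζ₃ ^ ℓ = ζ₃` with `ℓ ≡ 2 (3)` gives `ζ₃² = ζ₃`
        obtain ⟨c, hc⟩ : ∃ c, ℓ = 3 * c + 2 := ⟨ℓ / 3, by omega⟩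
        rw [hc, pow_add, pow_mul, hζ₃.pow_eq_one, one_pow, one_mul] at hspec
        have h1' : ζ₃ = 1 := by
          have : ζ₃ * ζ₃ = ζ₃ * 1 := by rw [mul_one, ← pow_two]; exact hspec
          exact mul_left_cancel₀ hne this
        exact hζ₃.ne_one (by norm_num) h1'
    · have hval : (-1 : ZMod 3).val = 2 := rfl
      rw [hm1, Units.val_neg, Units.val_one, hval] at hspec
      rcases hmod3 with hl | hl
      · exfalso
        obtain ⟨c, hc⟩ : ∃ c, ℓ = 3 * c + 1 := ⟨ℓ / 3, by omega⟩
        rw [hc, pow_add, pow_mul, hζ₃.pow_eq_one, one_pow, one_mul, pow_one] at hspec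
        have h1' : ζ₃ = 1 := by
          have : ζ₃ * ζ₃ = ζ₃ * 1 := by rw [mul_one, ← pow_two]; exact hspec.symm
          exact mul_left_cancel₀ hne this
        exact hζ₃.ne_one (by norm_num) h1'
      · rw [hm1, Units.val_neg, Units.val_one, hℓcast, hl]; rfl
  -- `φ` is fixed-point-free on `W[3]`
  have hA := mulVec_ne_of_trace_ne_one_add_det A (by rw [htrA, hdetA, add_comm]; exact ha)
  have hφfree : ∀ P : W.geomTorsion ((3 : ℕ) : ℤ), P ≠ 0 → φ • P ≠ P := by
    intro P hP h
    have hvne : e P ≠ 0 := fun h0 ↦ hP (e.injective (by simpa using h0))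
    refine hA (e P) hvne ?_
    have h' := hframe (galoisRepTorsion W ((3 : ℕ) : ℤ) φ) P
    rw [galoisRepTorsion_apply, h] at h'
    exact h'.symm
  exact notTrivialEisensteinModThreeAt_of_smul_ne W φ hφfree

/-- **hNT₃(3) is modulus-free**: on a global minimal model, `NotTrivialEisensteinModThreeAt W 3` holds iff SOME prime `ℓ ≠ 3` of good
reduction has `a_ℓ(W) ≢ ℓ + 1 (mod 3)` (i.e. iff `ρ̄_{W,3}` has a Frobenius without eigenvalue `1`). «⇒»: the instance `S = {3} ∪
{p ∣ Δ_min}`, `M = 0`. [cite: TateGCFT1967, §2.4 (Tchebotarev density theorem)] -/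
theorem notTrivialEisensteinModThreeAt_iff_exists_prime (W : WeierstrassCurve ℚ) [W.IsElliptic] [W.IsGloballyMinimal] :
    NotTrivialEisensteinModThreeAt W 3 ↔
      ∃ (ℓ : ℕ) (_ : Fact ℓ.Prime), ℓ ≠ 3 ∧ W.HasGoodReductionAtPrime ℓ ∧
        ((W.LFunction ℓ : ℤ) : ZMod 3) ≠ (ℓ : ZMod 3) + 1 := by
  classical
  constructor
  · intro h
    obtain ⟨r, hr, hrS, -, hne⟩ := h (insert 3 (minimalDiscriminantInt W).natAbs.primeFactors) 0
    haveI : Fact r.Prime := ⟨hr⟩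
    have hr3 : r ≠ 3 := fun h3 ↦ hrS (by rw [h3]; exact Finset.mem_insert_self _ _)
    have hrΔ : ¬ (r : ℤ) ∣ minimalDiscriminantInt W := fun hd ↦ hrS (Finset.mem_insert_of_mem
      (Nat.mem_primeFactors.mpr ⟨hr, Int.natCast_dvd.mp hd, Int.natAbs_ne_zero.mpr (minimalDiscriminantInt_ne_zero W)⟩))
    exact ⟨r, ⟨hr⟩, hr3, hasGoodReductionAtPrime_of_not_dvd W r hrΔ, hne⟩
  · rintro ⟨ℓ, hℓ, hℓ3, hgood, ha⟩
    exact notTrivialEisensteinModThreeAt_of_prime W hℓ3 hgood ha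


/-! ### §3  E-es-69♯: the residue identification -/

/-- **E-es-69♯ `NotTrivialEisensteinModThreeOfNoThreeTorsionOfNoMuThree` (es g19, MEMO-es §32.3; the `@[conjecture]` row of
`NotTrivialEisensteinLocalisationThree`) is a THEOREM** — and its hypothesis `¬ W.HasIrreducibleModPGaloisRep 3` is not used: for a
globally minimal elliptic `W` with an `X₀(N)`-datum `D` (only `c ≠ 0` is used, `maninConstant_ne_zero_holds`), no rational `3`-torsion
on the short model `E_{W,c}` and `W ⊉ μ₃` (`¬ HasShortMuThree W c`), hNT₃(3) holds.  If no `τ ∈ Γ_ℚ` were fixed-point-free on `W[3]`,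
Katz's case split (`exists_addOrderOf_eq_or_exists_trivialQuotientLine_of_forall_exists_smul_eq`) would give a rational point of order
`3` (`exists_isShortThreeTorsion_of_addOrderOf_eq_three`) or a stable `3`-line with trivial quotient character
(`hasShortMuThree_of_trivialQuotientLine`); otherwise §1. [cite: Katz1980, Thm. 2 (m = ℓ)] [cite: SilvermanAEC2009, Prop. III.8.1]
[cite: TateGCFT1967, §2.4 (Tchebotarev density theorem)] -/
theorem notTrivialEisensteinModThreeOfNoThreeTorsionOfNoMuThree_holds :
    NotTrivialEisensteinModThreeOfNoThreeTorsionOfNoMuThree := by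
  intro W _ _ N _ D _ _ hT hμ
  classical
  haveI : Fact (Nat.Prime 3) := ⟨Nat.prime_three⟩
  have hc : D.c ≠ 0 := D.maninConstant_ne_zero_holds
  obtain ⟨τ, hτ⟩ : ∃ τ : absoluteGaloisGroup ℚ, ∀ P : W.geomTorsion ((3 : ℕ) : ℤ), P ≠ 0 → τ • P ≠ P := by
    by_contra h
    push Not at h
    rcases exists_addOrderOf_eq_or_exists_trivialQuotientLine_of_forall_exists_smul_eq W 3 h with
      ⟨Q, hQ⟩ | ⟨H, hH, hst, htriv⟩
    · obtain ⟨X₀, Y₀, hXY⟩ := exists_isShortThreeTorsion_of_addOrderOf_eq_three W hc hQ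
      exact hT X₀ Y₀ hXY
    · exact hμ (hasShortMuThree_of_trivialQuotientLine W hc hH hst htriv)
  exact notTrivialEisensteinModThreeAt_of_smul_ne W τ hτ

/-- **es's EDGE 2 with two binders** (PROVED): the generic cut of E-es-61 from E-es-69 and E-es-69♮ alone — E-es-69♯ and E-es-40₃
are now theorems (`notTrivialEisensteinModThreeOfNoThreeTorsionOfNoMuThree_holds`, `notTrivialEisensteinModThreeOfIrreducible_holds`).
[cite: TateGCFT1967, §2.4 (Tchebotarev density theorem)] -/
theorem threeAdicUnitWitness_noMuThree_of_h69 (h69 : ThreeAdicWitnessOfNotTrivialEisenstein)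
    (h69n : NotTrivialEisensteinModThreeMultiplicative) :
    ThreeAdicUnitWitnessOfNoRationalThreeTorsionOfNoMuThree :=
  threeAdicUnitWitness_noMuThree_of_laws h69 h69n notTrivialEisensteinModThreeOfNoThreeTorsionOfNoMuThree_holds
    notTrivialEisensteinModThreeOfIrreducible_holds

/-- **The whole of E-es-61 from E-es-69, E-es-69♮ and the residue law pair E-es-66 ∘ E-es-67♯** (PROVED edge; was
`threeAdicUnitWitnessOfNoRationalThreeTorsion_of_hNT_laws` with the two extra binders `h69s`, `h40`).
[cite: TateGCFT1967, §2.4 (Tchebotarev density theorem)] -/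
theorem threeAdicUnitWitnessOfNoRationalThreeTorsion_of_h69_of_residue (h69 : ThreeAdicWitnessOfNotTrivialEisenstein)
    (h69n : NotTrivialEisensteinModThreeMultiplicative) (h66 : ThreeAdicWitnessOfPlusIndexPrimeToThree)
    (h67s : PlusIndexPrimeToThreeOfMuThreeNoRationalThreeTorsion) : ThreeAdicUnitWitnessOfNoRationalThreeTorsion :=
  threeAdicUnitWitnessOfNoRationalThreeTorsion_of_hNT_laws h69 h69n notTrivialEisensteinModThreeOfNoThreeTorsionOfNoMuThree_holds
    notTrivialEisensteinModThreeOfIrreducible_holds h66 h67s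

end Summit.BirchSwinnertonDyer.BirchSwinnertonDyer.Theorems.ManinLocalTwoThree

end
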